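import Summits.QuantumFields.BalabanUV.T4Continuum.Support.SubstrateSlotsOfRecord

/-!
# NE5 ∕ U3 — THE FORMAT-BOUNDEDNESS BINDERS `hbdA`∕`hbdB` AT THE SUBSTRATE's O1 INSTANCE ARE LETTER CONDITIONS ON THE FOUR TABLES

Cell `pub-balaban`, unit `b2b-balaban-t4-ne5-formalise-leaf-03` (NE5 formalisation swarm, LEAF PROVER 03, gen 11; socket-side follower of the
E9[rec] socket-fit probe `HOME/b2b-balaban-t4-ne5-formalise-leaf-03/g11/socketfit/ProbeSlotsOfRecordE9.lean` (CLAIMS.log l.15246, item P3) on the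
SUBSTRATE cell's `Support/SubstrateRawSpecies.lean` p219509 ∕ `Support/SubstrateSlotsOfRecord.lean` p220104).  Summits-side NEW WORK under the
LEAN PLACEMENT RULE (cell bookkeeping; 0 def; NOT a Literature module; R34: the instance is the substrate's — nothing of it is modified, this
file READS one of its displayed binders).  HONEST FRAMING: rung (B)+1 of the FINITE-VOLUME T⁴ continuum programme — NOT infinite volume, NOT
a mass gap, NOT the Clay problem, NOT a proof of NE5, NO estimate of any NE row and NO estimate of the covariance of record: a finite-index
bookkeeping fact about the SHAPE `B13OpDatum.FormatBounded` at the raw records of the instance.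
HONEST DEPENDENCY (cell line, verbatim): continuum YM on T⁴ ⇐ BetaPertH ∧ nine spine estimates (0/9 proved); BetaPertH ⇐ (D1) ∧ (D4) ∧
CAP+tail; G-an2-4 gates asym, D1 and NE2/3/4.

WHY.  Every END face of record applied at the substrate's O1 instance `slotsOfRecord …` (leaf-08-g5's cores road p221018, leaf-01-g11's E8
road p221190, this lineage's E9 road `B13StepEnvelopeEndSubstrate`) carries, per run, the binder
`hbdA : ∀ g U k, FormatBounded (L.W k).format (rawAOfRecord … g U k).kernel` (resp. `hbdB`) — so far read as «a one-run size, displayed».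
The raw record has FIVE species: the covariance species is CONSTRUCTED by the substrate (`covAtOfRecord`), the other four are LETTER tables
(`dk, gc, pQ, pR`).  This file shows the constructed component imposes NO condition: `hbdA`∕`hbdB` at the instance are EQUIVALENT to weighted
boundedness of the four letter tables (one radius per `g U k`).

WHAT IS PROVED (kernel; `[folklore]`):
* §1 `covAtOfRecord_eq_unit` (`rfl`) and **`formatBounded_rawOfRecord_iff`** — generic, one run (`rawOfRecord` of p219509).
* §2 **`formatBounded_rawA_slotsOfRecord_iff`** ∕ **`formatBounded_rawB_slotsOfRecord_iff`** — §1 at the two raw slots of the instance of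
  record `slotsOfRecord D ι c a s P 𝒵 dom Jc V mI L` (formats `(L.W k).format`, run A on torus `K` with `D.avA`∕`L.ΓA`∕`L.dkA…`, run B on torus
  `K + 1` with `D.avB`∕`L.ΓB`∕`L.dkB…`; definitional specialisation), and **`formatBounded_rawAOfRecord_iff`** ∕ **`formatBounded_rawBOfRecord_iff`**
  — the same `Iff`s in p221190's SYNTACTIC form `FormatBounded (L.W k).format (rawA∕BOfRecord …).kernel` (its `hbdA`∕`hbdB` VERBATIM, `rw`-ready).
0 sorry; axioms ⊆ {propext, Classical.choice, Quot.sound}.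
-/

noncomputable section

open scoped BigOperators
open _root_.MeasureTheory

namespace Summit.QuantumFields.BalabanUV.T4Continuum.B13SlotsOfRecordFormatBounded

open Literature.MathematicalPhysics.QuantumFieldTheory.Balaban1983to89
open Literature.MathematicalPhysics.QuantumFieldTheory.Balaban1983to89.B5Prop11Plancherel (Tor)
open Literature.MathematicalPhysics.QuantumFieldTheory.Balaban1983to89.B5G183RateUnitTower (lev)
open Summit.QuantumFields.BalabanUV.T4Continuum.CovariantBlockAveraging (ContourSystem)
open Summit.QuantumFields.BalabanUV.T4Continuum.B13OpDatum (Format Species RawSpecies OpDatum B13Weights FormatBounded InFormat)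
open Summit.QuantumFields.BalabanUV.T4Continuum.B13HistMeasurable (MeasPotFrame B13HistM)
open Summit.QuantumFields.BalabanUV.T4Continuum.B13StepTermLabels (InnerLabel)
open Summit.QuantumFields.BalabanUV.T4Continuum.B13InnerData (Bnd)
open Summit.QuantumFields.BalabanUV.T4Continuum.SubstrateBackgroundTransporters (unitMod)
open Summit.QuantumFields.BalabanUV.T4Continuum.SubstrateTwoRunsDriven (DrivenRuns)
open Summit.QuantumFields.BalabanUV.T4Continuum.SubstrateRawSpecies (covAtOfRecord rawOfRecord rawAOfRecord rawBOfRecord)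
open Summit.QuantumFields.BalabanUV.T4Continuum.SubstrateSlotsOfRecord (SlotLetters slotsOfRecord SpeciesRec)

/-! ## §1 One run: the raw record of p219509 -/

section OneRun

variable (P : Params) {G : Type*} [GaugeGroup G] {o : Type*} [Fintype o] [DecidableEq o] (ι : G →* Matrix o o ℂ)
variable (av : ∀ j, Averaging P j G) (c : ℂ) (a : ℝ) (s : ℕ → ℂ) (Γ : (k : ℕ) → ContourSystem P.d (lev P.L k) (unitMod P))
variable {T ι' S Ω 𝒴 : Type*}
  (dk : GaugeField P 0 G → ℕ → T → ι' → ι' → ℂ) (gc : GaugeField P 0 G → ℕ → T → ((Tor (unitMod P) × Fin P.d) × o) → ι' → ℂ)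
  (pQ : ℝ → GaugeField P 0 G → ℕ → Ω → 𝒴 → ((Tor (unitMod P) × Fin P.d) × o) → ((Tor (unitMod P) × Fin P.d) × o) → ℂ)
  (pR : ℝ → GaugeField P 0 G → ℕ → Ω → 𝒴 → ℂ)
  (Wk : B13Weights ((Tor (unitMod P) × Fin P.d) × o) ι' S 𝒴)

/-- [folklore] **SLOT-BLINDNESS ACROSS SLOT TYPES**: the covariance of record at any slot `t : T` of ANY slot type is its value at the unit
slot `() : Unit` (`rfl` — the definition never reads the slot; companion of p219509's same-type `covAtOfRecord_slot`). -/
theorem covAtOfRecord_eq_unit (U : GaugeField P 0 G) (k : ℕ) (t : T) (b b' : (Tor (unitMod P) × Fin P.d) × o) :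
    covAtOfRecord P ι av c a s Γ U k t b b' = covAtOfRecord P ι av c a s Γ U k () b b' := rfl

/-- [folklore] **FORMAT-BOUNDEDNESS OF A RUN's RAW RECORD IS A LETTER CONDITION.**  For every coupling sequence `g`, finest-lattice field `U`
and level `k`: `FormatBounded Wk.format (rawOfRecord P ι av c a s Γ dk gc pQ pR g U k).kernel` (the `hbdA`∕`hbdB` binder of the END faces of
record at the substrate's instance, one run) holds IFF ONE radius `R` bounds the four LETTER tables against their B13 weights —
`‖dk U k t i j‖ ≤ R·e^{−2δ d(p i, p j)}`, `‖gc U k t b i‖ ≤ R·e^{−2δ d(q b, p i)}`, `‖pQ (g (k−1)) U k x Y b b′‖ ≤ R·w(Y)k(b,b′)∕|τ(Y)|`,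
`‖pR (g (k−1)) U k x Y‖ ≤ R·v(Y)∕|τ(Y)|`.  The CONSTRUCTED covariance component costs nothing: it is slot-blind (`covAtOfRecord_eq_unit`), its
weight `e^{−δ d(q b, q b′)}` is slot-free, and the bond-pair index `((Tor (unitMod P) × Fin P.d) × o)²` is FINITE, so the double sum of its
weighted entries is a radius for it (proof: `max R 0 +` that sum).  No estimate of the covariance is involved or claimed. -/
theorem formatBounded_rawOfRecord_iff (g : ℕ → ℝ) (U : GaugeField P 0 G) (k : ℕ) :
    FormatBounded (Wk.format : Format (Species T ((Tor (unitMod P) × Fin P.d) × o) ι' Ω 𝒴))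
        (rawOfRecord P ι av c a s Γ dk gc pQ pR g U k).kernel ↔
      ∃ R : ℝ, (∀ (t : T) (i j : ι'), ‖dk U k t i j‖ ≤ R * Wk.wt (.deltaKer t i j : Species T ((Tor (unitMod P) × Fin P.d) × o) ι' Ω 𝒴)) ∧
        (∀ (t : T) (b : (Tor (unitMod P) × Fin P.d) × o) (i : ι'),
          ‖gc U k t b i‖ ≤ R * Wk.wt (.gammaConstituent t b i : Species T ((Tor (unitMod P) × Fin P.d) × o) ι' Ω 𝒴)) ∧
        (∀ (x : Ω) (Y : 𝒴) (b b' : (Tor (unitMod P) × Fin P.d) × o),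
          ‖pQ (g (k - 1)) U k x Y b b'‖ ≤ R * Wk.wt (.potQ x Y b b' : Species T ((Tor (unitMod P) × Fin P.d) × o) ι' Ω 𝒴)) ∧
        (∀ (x : Ω) (Y : 𝒴), ‖pR (g (k - 1)) U k x Y‖ ≤ R * Wk.wt (.potR x Y : Species T ((Tor (unitMod P) × Fin P.d) × o) ι' Ω 𝒴)) := by
  constructor
  · rintro ⟨R, h⟩
    exact ⟨R, fun t i j => h (.deltaKer t i j), fun t b i => h (.gammaConstituent t b i), fun x Y b b' => h (.potQ x Y b b'),
      fun x Y => h (.potR x Y)⟩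
  · rintro ⟨R, h1, h2, h3, h4⟩
    -- the free bound of the CONSTRUCTED covariance component: a finite sum of its weighted entries at the unit slot
    obtain ⟨C, hC0, hCov⟩ : ∃ C : ℝ, 0 ≤ C ∧ ∀ b b' : (Tor (unitMod P) × Fin P.d) × o,
        ‖covAtOfRecord P ι av c a s Γ U k () b b'‖ ≤ C * Real.exp (-(Wk.δ * Wk.d (Wk.q b) (Wk.q b'))) := by
      refine ⟨∑ b₀ : (Tor (unitMod P) × Fin P.d) × o, ∑ b₁ : (Tor (unitMod P) × Fin P.d) × o,
          ‖covAtOfRecord P ι av c a s Γ U k () b₀ b₁‖ / Real.exp (-(Wk.δ * Wk.d (Wk.q b₀) (Wk.q b₁))), ?_, fun b b' => ?_⟩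
      · exact Finset.sum_nonneg fun b₀ _ => Finset.sum_nonneg fun b₁ _ => div_nonneg (norm_nonneg _) (Real.exp_pos _).le
      · have hw : 0 < Real.exp (-(Wk.δ * Wk.d (Wk.q b) (Wk.q b'))) := Real.exp_pos _
        have h1 := Finset.single_le_sum (s := Finset.univ)
          (f := fun b₁ : (Tor (unitMod P) × Fin P.d) × o =>
            ‖covAtOfRecord P ι av c a s Γ U k () b b₁‖ / Real.exp (-(Wk.δ * Wk.d (Wk.q b) (Wk.q b₁))))
          (fun b₁ _ => div_nonneg (norm_nonneg _) (Real.exp_pos _).le) (Finset.mem_univ b')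
        have h2 := Finset.single_le_sum (s := Finset.univ)
          (f := fun b₀ : (Tor (unitMod P) × Fin P.d) × o => ∑ b₁ : (Tor (unitMod P) × Fin P.d) × o,
            ‖covAtOfRecord P ι av c a s Γ U k () b₀ b₁‖ / Real.exp (-(Wk.δ * Wk.d (Wk.q b₀) (Wk.q b₁))))
          (fun b₀ _ => Finset.sum_nonneg fun b₁ _ => div_nonneg (norm_nonneg _) (Real.exp_pos _).le) (Finset.mem_univ b)
        exact (div_le_iff₀ hw).mp (h1.trans h2)
    have hR : R ≤ max R 0 + C := (le_max_left R 0).trans (le_add_of_nonneg_right hC0)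
    have hCle : C ≤ max R 0 + C := le_add_of_nonneg_left (le_max_right R 0)
    refine ⟨max R 0 + C, fun e => ?_⟩
    cases e with
    | cov t b b' =>
        simp only [RawSpecies.kernel, rawOfRecord, SubstrateRawSpecies.rawOfGreen, B13Weights.format_wt, B13Weights.wt]
        rw [covAtOfRecord_eq_unit P ι av c a s Γ U k t b b']
        exact (hCov b b').trans (mul_le_mul_of_nonneg_right hCle (Real.exp_pos _).le)
    | deltaKer t i j =>
        exact (h1 t i j).trans (mul_le_mul_of_nonneg_right hR (Wk.wt_pos _).le)
    | gammaConstituent t b i =>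
        exact (h2 t b i).trans (mul_le_mul_of_nonneg_right hR (Wk.wt_pos _).le)
    | potQ x Y b b' =>
        exact (h3 x Y b b').trans (mul_le_mul_of_nonneg_right hR (Wk.wt_pos _).le)
    | potR x Y =>
        exact (h4 x Y).trans (mul_le_mul_of_nonneg_right hR (Wk.wt_pos _).le)

end OneRun

/-! ## §2 The two raw slots of the substrate's instance of record -/

section Instance

variable {G : Type} [GaugeGroup G] (D : DrivenRuns G)
variable {o : Type} [Fintype o] [DecidableEq o] (ι : G →* Matrix o o ℂ) (c : ℂ) (a : ℝ) (s : ℕ → ℂ)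
variable {T ι' S Ω 𝒴 : Type} (P : MeasPotFrame D.carriers) {IOp : Type*}
  (𝒵 : D.carriers.Dom → InnerLabel D.carriers.Dom (Bnd D.toTwoRuns) → Type) [∀ Z j, Fintype (𝒵 Z j)] (dom : ∀ Z j, 𝒵 Z j → D.carriers.Dom)
  (Jc : D.carriers.Dom → InnerLabel D.carriers.Dom (Bnd D.toTwoRuns) → Type) [∀ Z j, Fintype (Jc Z j)]
  (V : D.carriers.Dom → InnerLabel D.carriers.Dom (Bnd D.toTwoRuns) → Type) [∀ Z j, NormedAddCommGroup (V Z j)]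
  [∀ Z j, InnerProductSpace ℝ (V Z j)] [∀ Z j, MeasurableSpace (V Z j)] [∀ Z j, BorelSpace (V Z j)] [∀ Z j, FiniteDimensional ℝ (V Z j)]
  (mI : D.carriers.Dom → InnerLabel D.carriers.Dom (Bnd D.toTwoRuns) → Type) [∀ Z j, Fintype (mI Z j)] [∀ Z j, DecidableEq (mI Z j)]
variable (L : SlotLetters D (o := o) (T := T) (ι' := ι') (S := S) (Ω := Ω) (𝒴 := 𝒴) P (IOp := IOp) 𝒵 dom Jc V mI)

/-- [folklore] **RUN A: `hbdA` AT THE INSTANCE IS A LETTER CONDITION** — `FormatBounded ((slotsOfRecord …).F k) ((slotsOfRecord …).rawA g V k)`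
(VERBATIM the `hbdA` binder of the END faces at the instance, definitionally `FormatBounded (L.W k).format (rawAOfRecord … g V k).kernel`) IFF
one radius bounds run A's four letter tables `L.dkA V.1 k`, `L.gcA V.1 k`, `L.pQA (g (k−1)) V.1 k`, `L.pRA (g (k−1)) V.1 k` against the weights of
`L.W k`; the constructed covariance of record (torus `K`, averagings `D.avA`, contours `L.ΓA`) costs nothing (§1). -/
theorem formatBounded_rawA_slotsOfRecord_iff (g : ℕ → ℝ) (W : D.carriers.BgA) (k : ℕ) :
    FormatBounded ((slotsOfRecord D ι c a s P 𝒵 dom Jc V mI L).F k) ((slotsOfRecord D ι c a s P 𝒵 dom Jc V mI L).rawA g W k) ↔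
      ∃ R : ℝ, (∀ (t : T) (i j : ι'), ‖L.dkA W.1 k t i j‖ ≤ R * (L.W k).wt (.deltaKer t i j : SpeciesRec D o T ι' Ω 𝒴)) ∧
        (∀ (t : T) (b : ((Tor (unitMod (D.F.P D.K)) × Fin (D.F.P D.K).d) × o)) (i : ι'), ‖L.gcA W.1 k t b i‖ ≤ R * (L.W k).wt (.gammaConstituent t b i : SpeciesRec D o T ι' Ω 𝒴)) ∧
        (∀ (x : Ω) (Y : 𝒴) (b b' : ((Tor (unitMod (D.F.P D.K)) × Fin (D.F.P D.K).d) × o)),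
          ‖L.pQA (g (k - 1)) W.1 k x Y b b'‖ ≤ R * (L.W k).wt (.potQ x Y b b' : SpeciesRec D o T ι' Ω 𝒴)) ∧
        (∀ (x : Ω) (Y : 𝒴), ‖L.pRA (g (k - 1)) W.1 k x Y‖ ≤ R * (L.W k).wt (.potR x Y : SpeciesRec D o T ι' Ω 𝒴)) :=
  formatBounded_rawOfRecord_iff (D.F.P D.K) ι D.avA c a s L.ΓA L.dkA L.gcA L.pQA L.pRA (L.W k) g W.1 k

/-- [folklore] **RUN B: `hbdB` AT THE INSTANCE IS A LETTER CONDITION** — the same for `(slotsOfRecord …).rawB g U k` (torus `K + 1`, averagings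
`D.avB`, contours `L.ΓB`, tables `L.dkB`, `L.gcB`, `L.pQB (g (k−1))`, `L.pRB (g (k−1))` at `U.1`; run B's bond-pair index type is run A's
definitionally — both unit tori have the same side, `SubstrateSlotsOfRecord.SpeciesRec`). -/
theorem formatBounded_rawB_slotsOfRecord_iff (g : ℕ → ℝ) (U : D.carriers.BgB) (k : ℕ) :
    FormatBounded ((slotsOfRecord D ι c a s P 𝒵 dom Jc V mI L).F k) ((slotsOfRecord D ι c a s P 𝒵 dom Jc V mI L).rawB g U k) ↔
      ∃ R : ℝ, (∀ (t : T) (i j : ι'), ‖L.dkB U.1 k t i j‖ ≤ R * (L.W k).wt (.deltaKer t i j : SpeciesRec D o T ι' Ω 𝒴)) ∧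
        (∀ (t : T) (b : ((Tor (unitMod (D.F.P D.K)) × Fin (D.F.P D.K).d) × o)) (i : ι'), ‖L.gcB U.1 k t b i‖ ≤ R * (L.W k).wt (.gammaConstituent t b i : SpeciesRec D o T ι' Ω 𝒴)) ∧
        (∀ (x : Ω) (Y : 𝒴) (b b' : ((Tor (unitMod (D.F.P D.K)) × Fin (D.F.P D.K).d) × o)),
          ‖L.pQB (g (k - 1)) U.1 k x Y b b'‖ ≤ R * (L.W k).wt (.potQ x Y b b' : SpeciesRec D o T ι' Ω 𝒴)) ∧
        (∀ (x : Ω) (Y : 𝒴), ‖L.pRB (g (k - 1)) U.1 k x Y‖ ≤ R * (L.W k).wt (.potR x Y : SpeciesRec D o T ι' Ω 𝒴)) :=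
  formatBounded_rawOfRecord_iff (D.F.P (D.K + 1)) ι D.avB c a s L.ΓB L.dkB L.gcB L.pQB L.pRB (L.W k) g U.1 k

omit [∀ Z j, Fintype (𝒵 Z j)] [∀ Z j, Fintype (Jc Z j)] [∀ Z j, BorelSpace (V Z j)] [∀ Z j, FiniteDimensional ℝ (V Z j)]
  [∀ Z j, DecidableEq (mI Z j)] in
/-- [folklore] **RUN A, IN p221190's SYNTACTIC FORM** — the same `Iff` stated on `FormatBounded (L.W k).format (rawAOfRecord ι D c a s L.ΓA L.dkA L.gcA
L.pQA L.pRA g V k).kernel` (VERBATIM the `hbdA` binder of `B13StepOfRecordSubstrate` p221190 ∕ `B13AssemblyCoresEndRestrictRecord` p221018, so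
that consumers can `rw` without unfolding `slotsOfRecord`). -/
theorem formatBounded_rawAOfRecord_iff (g : ℕ → ℝ) (W : D.carriers.BgA) (k : ℕ) :
    FormatBounded (L.W k).format (rawAOfRecord ι D c a s L.ΓA L.dkA L.gcA L.pQA L.pRA g W k).kernel ↔
      ∃ R : ℝ, (∀ (t : T) (i j : ι'), ‖L.dkA W.1 k t i j‖ ≤ R * (L.W k).wt (.deltaKer t i j : SpeciesRec D o T ι' Ω 𝒴)) ∧
        (∀ (t : T) (b : ((Tor (unitMod (D.F.P D.K)) × Fin (D.F.P D.K).d) × o)) (i : ι'), ‖L.gcA W.1 k t b i‖ ≤ R * (L.W k).wt (.gammaConstituent t b i : SpeciesRec D o T ι' Ω 𝒴)) ∧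
        (∀ (x : Ω) (Y : 𝒴) (b b' : ((Tor (unitMod (D.F.P D.K)) × Fin (D.F.P D.K).d) × o)),
          ‖L.pQA (g (k - 1)) W.1 k x Y b b'‖ ≤ R * (L.W k).wt (.potQ x Y b b' : SpeciesRec D o T ι' Ω 𝒴)) ∧
        (∀ (x : Ω) (Y : 𝒴), ‖L.pRA (g (k - 1)) W.1 k x Y‖ ≤ R * (L.W k).wt (.potR x Y : SpeciesRec D o T ι' Ω 𝒴)) :=
  formatBounded_rawOfRecord_iff (D.F.P D.K) ι D.avA c a s L.ΓA L.dkA L.gcA L.pQA L.pRA (L.W k) g W.1 k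

omit [∀ Z j, Fintype (𝒵 Z j)] [∀ Z j, Fintype (Jc Z j)] [∀ Z j, BorelSpace (V Z j)] [∀ Z j, FiniteDimensional ℝ (V Z j)]
  [∀ Z j, DecidableEq (mI Z j)] in
/-- [folklore] **RUN B, IN p221190's SYNTACTIC FORM** — on `FormatBounded (L.W k).format (rawBOfRecord ι D c a s L.ΓB L.dkB L.gcB L.pQB L.pRB g U
k).kernel` (VERBATIM the `hbdB` binder there). -/
theorem formatBounded_rawBOfRecord_iff (g : ℕ → ℝ) (U : D.carriers.BgB) (k : ℕ) :
    FormatBounded (L.W k).format (rawBOfRecord ι D c a s L.ΓB L.dkB L.gcB L.pQB L.pRB g U k).kernel ↔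
      ∃ R : ℝ, (∀ (t : T) (i j : ι'), ‖L.dkB U.1 k t i j‖ ≤ R * (L.W k).wt (.deltaKer t i j : SpeciesRec D o T ι' Ω 𝒴)) ∧
        (∀ (t : T) (b : ((Tor (unitMod (D.F.P D.K)) × Fin (D.F.P D.K).d) × o)) (i : ι'), ‖L.gcB U.1 k t b i‖ ≤ R * (L.W k).wt (.gammaConstituent t b i : SpeciesRec D o T ι' Ω 𝒴)) ∧
        (∀ (x : Ω) (Y : 𝒴) (b b' : ((Tor (unitMod (D.F.P D.K)) × Fin (D.F.P D.K).d) × o)),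
          ‖L.pQB (g (k - 1)) U.1 k x Y b b'‖ ≤ R * (L.W k).wt (.potQ x Y b b' : SpeciesRec D o T ι' Ω 𝒴)) ∧
        (∀ (x : Ω) (Y : 𝒴), ‖L.pRB (g (k - 1)) U.1 k x Y‖ ≤ R * (L.W k).wt (.potR x Y : SpeciesRec D o T ι' Ω 𝒴)) :=
  formatBounded_rawOfRecord_iff (D.F.P (D.K + 1)) ι D.avB c a s L.ΓB L.dkB L.gcB L.pQB L.pRB (L.W k) g U.1 k

end Instance

end Summit.QuantumFields.BalabanUV.T4Continuum.B13SlotsOfRecordFormatBounded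

end
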